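import Summits.Ventures.HodgeRepro2.T6MainM1C
import Summits.Ventures.HodgeRepro2.T6PeriodInput7
import Summits.Ventures.HodgeRepro2.T6A2WeilHostDatum

/-!
# T6MainM2Stmt — THE M2-FINAL STATEMENT (README §10.4 M2; the form of record of §10.4 as amended: the statement as a `Prop`,
the closed theorem inhabiting it in T6MainM2)

Cell pub-hodge-repro2, Tier 6 (README §10). Built by seat t6-p6 (gen 11) on the lead's word (STATUS l. 12079 (3) «BUILD IT»;
the SHAPE RULING l. 12137: on t6-p2's landed seam, no `P`, no `htie`); the lead's file, filed by t6-lead (g6), the lead's names and binder order.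
Two files because the gate's lint caps proof files at 400 lines and the statement alone is ≈ 500 (the 170 lifted binders);
statement-only files may have 1000.

`HCCMOfPublished₂ : Prop` = «`HostAPI.HCCM.Statement` follows from the published displays and the M2 datum»: the nine
binders of `hccm_of_published_M1C` (T6MainM1C, p416362 — M1 (host) DECLARED, STATUS l. 12121) with its ONE (N) binder
`Hyp.PeriodNHostC` REPLACED by (a) THE N SIDE'S PARAMETERS, per Betti datum and corner product (TIER5 (N0.1)(b), (N0.2)
(q2)–(q5)): the choices `Choice`, their admissibility `Adm`, the surface datum `surf c = (S = S_ν, f = (f_i))` of each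
choice (TIER4 §D, `SurfaceDatum`), the base embedding `τ₁` and the eigenline generators `e` with `e_mem` — six data binders,
nothing of the host fixes them; (b) THE AUTOMORPHIC DATUM `M : NAut3 C.F (NDatum.ofHostShadow …)` (T6NAut3, v3) over the
M2 period datum of record `NDatum.ofHostShadow` (T6A2WeilHostDatum, p416673): its `shadow c` IS W14's host shadow
`shadowOf … (surf c).S (surf c).hS (surf c).f …` (`NDatum.ofHostShadow_shadow`, rfl) — the close seam is discharged BY
CONSTRUCTION, no row condition; (c) the 170 binders of `periodInputN_of_published₇` (T6PeriodInput7.lean ll. 56–174; the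
M2 object of record, M2 DECLARED v7, STATUS l. 12036), each lifted under `∀ Bd hB K [..] C` in v7's order with the same
names and comments at `M Bd hB K C` (v7's implicit `ιA` / `ιB` made explicit — data binders of a `Prop`), `M ↦ M Bd hB K C`,
every earlier binder `x ↦ x Bd hB K C` — generated mechanically from the accepted v7 bytes
(route/t6-p6-lean/checks/T6MainM2-gen_m2final.py), so no display is paraphrased. v7 is MODULO-DATUM (t6-ref-2's rider):
its binders hold at this datum as binders. Conclusion: `HostAPI.HCCM.Statement`, literally. No new display, no new
definition; count-neutral. §8(d): uses an L-value-free non-vanishing device: NO.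
-/

noncomputable section

open CategoryTheory
open HostAPI.Carriers.AlgebraicGeometry.Motives HostAPI.Carriers.AlgebraicGeometry.HodgeTheory

namespace Summit.Ventures.HodgeRepro2.T6

open Summit.Ventures.HodgeRepro2.T6.Host Summit.Ventures.HodgeRepro2.T6.WeilInst
  Summit.Ventures.HodgeRepro2.T6.WeilAssembly Summit.Ventures.HodgeRepro2.T6.A1HostBridge
  Summit.Ventures.HodgeRepro2.T6.HostCoeff
open N5Skeleton
open scoped InnerProductSpace

/-- **THE M2-FINAL STATEMENT** (README §10.4 M2): `HostAPI.HCCM.Statement` — the host's statement of the Hodge conjecture for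
complex abelian varieties of CM type, literally — from the nine M1 displays (T6MainM1C's binders verbatim), the N side's
parameters `Choice Adm surf τ₁ e e_mem` per Betti datum and corner product, the automorphic datum `M` over the host-shadow
period datum `NDatum.ofHostShadow …`, and the 170 binders of `periodInputN_of_published₇` at `M Bd hB K C`. The `Prop` of
record; its proof `hccmOfPublished₂_holds` is T6MainM2. -/
def HCCMOfPublished₂ : Prop :=
  ∀ (h0 : Hyp.HodgeModelExists) (hS4 : Hyp.Given_S4)
    (hBd : Hyp.BettiHodge coeffC₀) (h17 : Hyp.LangeBirkenhake1992_Lemma1_1_17)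
    (hD : ∀ Bd, BettiClauses coeffC₀ Bd → Hyp.LangeBirkenhake1992_Prop1_1_20 Bd)
    (hLefD : ∀ Bd, BettiClauses coeffC₀ Bd → Hyp.Lefschetz11_Betti Bd)
    (hT21 : ∀ Bd, BettiClauses coeffC₀ Bd → Hyp.LangeBirkenhake1992_Thm1_1_21_Betti Bd)
    (hProd : Hyp.Hartshorne1977_productProjective) (hPt : Hyp.Hartshorne1977_pointProjective)
    -- (a) the N side's parameters per Betti datum and corner product (TIER5 (N0.1)(b), (N0.2)(q2)–(q5)): the choices,
    -- their admissibility, the surface datum `(S, f)` of each choice, the base embedding, the eigenline generators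
    (Choice : ∀ (Bd : BettiHodgeData ℂ) (hB : BettiClauses coeffC₀ Bd) (K : Type) [Field K] [NumberField K] [IsGalois ℚ K] [NumberField.IsCMField K] (C : CornerProduct K), Type)
    (Adm : ∀ (Bd : BettiHodgeData ℂ) (hB : BettiClauses coeffC₀ Bd) (K : Type) [Field K] [NumberField K] [IsGalois ℚ K] [NumberField.IsCMField K] (C : CornerProduct K), Choice Bd hB K C → Prop)
    (surf : ∀ (Bd : BettiHodgeData ℂ) (hB : BettiClauses coeffC₀ Bd) (K : Type) [Field K] [NumberField K] [IsGalois ℚ K] [NumberField.IsCMField K] (C : CornerProduct K), Choice Bd hB K C → SurfaceDatum C)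
    (τ₁ : ∀ (Bd : BettiHodgeData ℂ) (hB : BettiClauses coeffC₀ Bd) (K : Type) [Field K] [NumberField K] [IsGalois ℚ K] [NumberField.IsCMField K] (C : CornerProduct K), K →+* ℂ)
    (e : ∀ (Bd : BettiHodgeData ℂ) (hB : BettiClauses coeffC₀ Bd) (K : Type) [Field K] [NumberField K] [IsGalois ℚ K] [NumberField.IsCMField K] (C : CornerProduct K), (K →+* ℂ) → Fin 4 → H1C K)
    (e_mem : ∀ (Bd : BettiHodgeData ℂ) (hB : BettiClauses coeffC₀ Bd) (K : Type) [Field K] [NumberField K] [IsGalois ℚ K] [NumberField.IsCMField K] (C : CornerProduct K), ∀ σ i, e Bd hB K C σ i ∈ eigenLine K i σ)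
    -- (b) the automorphic datum over the host-shadow period datum (the close seam discharged by construction)
    (M : ∀ (Bd : BettiHodgeData ℂ) (hB : BettiClauses coeffC₀ Bd) (K : Type) [Field K] [NumberField K]
      [IsGalois ℚ K] [NumberField.IsCMField K] (C : CornerProduct K), NAut3 C.F (NDatum.ofHostShadow coeffC₀
      Bd coeffNatural hB C (lemma1117Q_of_display h17) (hD Bd hB) (hLefD Bd hB) (hT21 Bd hB) hProd hPt (Choice
      Bd hB K C) (Adm Bd hB K C) (surf Bd hB K C) (τ₁ Bd hB K C) (e Bd hB K C) (e_mem Bd hB K C)))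
    -- (c) the 170 binders of `periodInputN_of_published₇`, lifted under `∀ Bd hB K [..] C` (v7's names, order, comments)
    -- v2: every quadruple of Schwartz data is the data of some choice (EX, by construction on the host)
    (hex : ∀ (Bd : BettiHodgeData ℂ) (hB : BettiClauses coeffC₀ Bd) (K : Type) [Field K] [NumberField K]
      [IsGalois ℚ K] [NumberField.IsCMField K] (C : CornerProduct K), ∀ (φa : (M Bd hB K C).d3.A.Sa) (φb : (M
      Bd hB K C).d3.A.Sb) (φc : (M Bd hB K C).d3.B.Sa) (φd : (M Bd hB K C).d3.B.Sb), ∃ c, (M Bd hB K C).data c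
      = (φa, φb, φc, φd))
    -- N2 (t6-p5): the datum's explicit shape [EX ×4, no display], for `N2_main_explicit`
    (hfr : ∀ (Bd : BettiHodgeData ℂ) (hB : BettiClauses coeffC₀ Bd) (K : Type) [Field K] [NumberField K]
      [IsGalois ℚ K] [NumberField.IsCMField K] (C : CornerProduct K), T5CubeTypes.IsCMFrame (M Bd hB K
      C).d2.τ)
    (h₁₁₁ : ∀ (Bd : BettiHodgeData ℂ) (hB : BettiClauses coeffC₀ Bd) (K : Type) [Field K] [NumberField K]
      [IsGalois ℚ K] [NumberField.IsCMField K] (C : CornerProduct K), IsLiuSignElement K ((M Bd hB K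
      C).d2.type T5DatumSimilitude.t111) (M Bd hB K C).d2.e₁₁₁)
    (hm : ∀ (Bd : BettiHodgeData ℂ) (hB : BettiClauses coeffC₀ Bd) (K : Type) [Field K] [NumberField K]
      [IsGalois ℚ K] [NumberField.IsCMField K] (C : CornerProduct K), N2ToyIso.MagSpec (M Bd hB K C).d2.τ (M
      Bd hB K C).d2.u)
    (he : ∀ (Bd : BettiHodgeData ℂ) (hB : BettiClauses coeffC₀ Bd) (K : Type) [Field K] [NumberField K]
      [IsGalois ℚ K] [NumberField.IsCMField K] (C : CornerProduct K), (M Bd hB K C).d2.e₁₀₀ = (M Bd hB K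
      C).d2.u * (1 - (M Bd hB K C).d2.u) * (M Bd hB K C).d2.e₁₁₁)
    -- N3iso (t6-p3): the binders of `N3iso_main₂` — the sentence N2 and N3 share [AD], Rogawski 1990
    -- §14.6 / 14.6.4 / 14.6.5 on the packet carrier `R` [displays], the Π_s residual [AD], the dictionary
    -- `hRbr` [AD] and the N3.L8 interface Props [AD]
    (hAdm : ∀ (Bd : BettiHodgeData ℂ) (hB : BettiClauses coeffC₀ Bd) (K : Type) [Field K] [NumberField K]
      [IsGalois ℚ K] [NumberField.IsCMField K] (C : CornerProduct K), (M Bd hB K C).d2.AdmGenerating)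
    (R : ∀ (Bd : BettiHodgeData ℂ) (hB : BettiClauses coeffC₀ Bd) (K : Type) [Field K] [NumberField K]
      [IsGalois ℚ K] [NumberField.IsCMField K] (C : CornerProduct K), RogawskiPackets)
    (hR0 : ∀ (Bd : BettiHodgeData ℂ) (hB : BettiClauses coeffC₀ Bd) (K : Type) [Field K] [NumberField K]
      [IsGalois ℚ K] [NumberField.IsCMField K] (C : CornerProduct K), Hyp.Rogawski1990_Sec14_6_Partition (R Bd
      hB K C))
    (hR1 : ∀ (Bd : BettiHodgeData ℂ) (hB : BettiClauses coeffC₀ Bd) (K : Type) [Field K] [NumberField K]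
      [IsGalois ℚ K] [NumberField.IsCMField K] (C : CornerProduct K), Hyp.Rogawski1990_Thm14_6_4 (R Bd hB K
      C))
    (hR2 : ∀ (Bd : BettiHodgeData ℂ) (hB : BettiClauses coeffC₀ Bd) (K : Type) [Field K] [NumberField K]
      [IsGalois ℚ K] [NumberField.IsCMField K] (C : CornerProduct K), Hyp.Rogawski1990_Thm14_6_5 (R Bd hB K
      C))
    (hs : ∀ (Bd : BettiHodgeData ℂ) (hB : BettiClauses coeffC₀ Bd) (K : Type) [Field K] [NumberField K]
      [IsGalois ℚ K] [NumberField.IsCMField K] (C : CornerProduct K), ∀ P' ∈ (R Bd hB K C).Ps, ∀ π, (R Bd hB K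
      C).mem π P' → (R Bd hB K C).m π ≤ 1)
    (hst : ∀ (Bd : BettiHodgeData ℂ) (hB : BettiClauses coeffC₀ Bd) (K : Type) [Field K] [NumberField K]
      [IsGalois ℚ K] [NumberField.IsCMField K] (C : CornerProduct K), (M Bd hB K C).d3.AutStable)
    (hRbr : ∀ (Bd : BettiHodgeData ℂ) (hB : BettiClauses coeffC₀ Bd) (K : Type) [Field K] [NumberField K]
      [IsGalois ℚ K] [NumberField.IsCMField K] (C : CornerProduct K), (M Bd hB K C).d3.RogawskiBridge (R Bd hB
      K C) (hst Bd hB K C))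
    (hO : ∀ (Bd : BettiHodgeData ℂ) (hB : BettiClauses coeffC₀ Bd) (K : Type) [Field K] [NumberField K]
      [IsGalois ℚ K] [NumberField.IsCMField K] (C : CornerProduct K), (M Bd hB K C).d3.AutOrthogonal)
    (hsimp : ∀ (Bd : BettiHodgeData ℂ) (hB : BettiClauses coeffC₀ Bd) (K : Type) [Field K] [NumberField K]
      [IsGalois ℚ K] [NumberField.IsCMField K] (C : CornerProduct K), (M Bd hB K C).d3.AutSimple)
    (hPX : ∀ (Bd : BettiHodgeData ℂ) (hB : BettiClauses coeffC₀ Bd) (K : Type) [Field K] [NumberField K]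
      [IsGalois ℚ K] [NumberField.IsCMField K] (C : CornerProduct K), (M Bd hB K C).d3.ProductsIn20 (M Bd hB K
      C).d3.A)
    (hPeqX : ∀ (Bd : BettiHodgeData ℂ) (hB : BettiClauses coeffC₀ Bd) (K : Type) [Field K] [NumberField K]
      [IsGalois ℚ K] [NumberField.IsCMField K] (C : CornerProduct K), (M Bd hB K C).d3.ProductEquivariant (M
      Bd hB K C).d3.A)
    (hPY : ∀ (Bd : BettiHodgeData ℂ) (hB : BettiClauses coeffC₀ Bd) (K : Type) [Field K] [NumberField K]
      [IsGalois ℚ K] [NumberField.IsCMField K] (C : CornerProduct K), (M Bd hB K C).d3.ProductsIn20 (M Bd hB K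
      C).d3.B)
    (hPeqY : ∀ (Bd : BettiHodgeData ℂ) (hB : BettiClauses coeffC₀ Bd) (K : Type) [Field K] [NumberField K]
      [IsGalois ℚ K] [NumberField.IsCMField K] (C : CornerProduct K), (M Bd hB K C).d3.ProductEquivariant (M
      Bd hB K C).d3.B)
    (hσX : ∀ (Bd : BettiHodgeData ℂ) (hB : BettiClauses coeffC₀ Bd) (K : Type) [Field K] [NumberField K]
      [IsGalois ℚ K] [NumberField.IsCMField K] (C : CornerProduct K), (M Bd hB K C).d3.SigmaIsAut (M Bd hB K
      C).d3.A)
    (hσ : ∀ (Bd : BettiHodgeData ℂ) (hB : BettiClauses coeffC₀ Bd) (K : Type) [Field K] [NumberField K]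
      [IsGalois ℚ K] [NumberField.IsCMField K] (C : CornerProduct K), (M Bd hB K C).d3.B.σ = (M Bd hB K
      C).d3.A.σ)
    -- N1 (t6-p1): the four displays of T6N1Hyp on the carrier's N1 datum
    (hN1H : ∀ (Bd : BettiHodgeData ℂ) (hB : BettiClauses coeffC₀ Bd) (K : Type) [Field K] [NumberField K]
      [IsGalois ℚ K] [NumberField.IsCMField K] (C : CornerProduct K), Hyp.Voisin2002_7_3_2 (M Bd hB K C).d1)
    (hN1L : ∀ (Bd : BettiHodgeData ℂ) (hB : BettiClauses coeffC₀ Bd) (K : Type) [Field K] [NumberField K]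
      [IsGalois ℚ K] [NumberField.IsCMField K] (C : CornerProduct K), Hyp.Voisin2002_Lemma5_4_petersson (M Bd
      hB K C).d1)
    (hN1A : ∀ (Bd : BettiHodgeData ℂ) (hB : BettiClauses coeffC₀ Bd) (K : Type) [Field K] [NumberField K]
      [IsGalois ℚ K] [NumberField.IsCMField K] (C : CornerProduct K), Hyp.Liu2021_Prop4_13_vertexLiftA (M Bd
      hB K C).d1)
    (hN1B : ∀ (Bd : BettiHodgeData ℂ) (hB : BettiClauses coeffC₀ Bd) (K : Type) [Field K] [NumberField K]
      [IsGalois ℚ K] [NumberField.IsCMField K] (C : CornerProduct K), Hyp.Liu2021_Prop4_13_vertexLiftB (M Bd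
      hB K C).d1)
    -- N3A (t6-p3): Gan–Takeda at the non-archimedean places + the class-AD interface Props, side A
    (ιA : ∀ (Bd : BettiHodgeData ℂ) (hB : BettiClauses coeffC₀ Bd) (K : Type) [Field K] [NumberField K]
      [IsGalois ℚ K] [NumberField.IsCMField K] (C : CornerProduct K), Type)
    (LA : ∀ (Bd : BettiHodgeData ℂ) (hB : BettiClauses coeffC₀ Bd) (K : Type) [Field K] [NumberField K]
      [IsGalois ℚ K] [NumberField.IsCMField K] (C : CornerProduct K), (ιA Bd hB K C) → HoweDualityShape)
    (hHDA : ∀ (Bd : BettiHodgeData ℂ) (hB : BettiClauses coeffC₀ Bd) (K : Type) [Field K] [NumberField K]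
      [IsGalois ℚ K] [NumberField.IsCMField K] (C : CornerProduct K), ∀ v, Hyp.GanTakeda2016_Thm1_2 ((LA Bd hB
      K C) v))
    (hHDbrA : ∀ (Bd : BettiHodgeData ℂ) (hB : BettiClauses coeffC₀ Bd) (K : Type) [Field K] [NumberField K]
      [IsGalois ℚ K] [NumberField.IsCMField K] (C : CornerProduct K), (M Bd hB K C).d3.HoweDualityBridge (LA
      Bd hB K C) (M Bd hB K C).d3.A)
    (hKCA : ∀ (Bd : BettiHodgeData ℂ) (hB : BettiClauses coeffC₀ Bd) (K : Type) [Field K] [NumberField K]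
      [IsGalois ℚ K] [NumberField.IsCMField K] (C : CornerProduct K), (M Bd hB K C).d3.A.KliftCont)
    (hSeamA : ∀ (Bd : BettiHodgeData ℂ) (hB : BettiClauses coeffC₀ Bd) (K : Type) [Field K] [NumberField K]
      [IsGalois ℚ K] [NumberField.IsCMField K] (C : CornerProduct K), (M Bd hB K C).d3.A.Seam (hKCA Bd hB K
      C))
    (hAdjA : ∀ (Bd : BettiHodgeData ℂ) (hB : BettiClauses coeffC₀ Bd) (K : Type) [Field K] [NumberField K]
      [IsGalois ℚ K] [NumberField.IsCMField K] (C : CornerProduct K), (M Bd hB K C).d3.A.Adjoint)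
    (hKLA : ∀ (Bd : BettiHodgeData ℂ) (hB : BettiClauses coeffC₀ Bd) (K : Type) [Field K] [NumberField K]
      [IsGalois ℚ K] [NumberField.IsCMField K] (C : CornerProduct K), (M Bd hB K C).d3.A.KliftLevel)
    (hΘτA : ∀ (Bd : BettiHodgeData ℂ) (hB : BettiClauses coeffC₀ Bd) (K : Type) [Field K] [NumberField K]
      [IsGalois ℚ K] [NumberField.IsCMField K] (C : CornerProduct K), (M Bd hB K C).d3.A.ThetaTauType (M Bd hB
      K C).d3.τiso)
    (hEA : ∀ (Bd : BettiHodgeData ℂ) (hB : BettiClauses coeffC₀ Bd) (K : Type) [Field K] [NumberField K]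
      [IsGalois ℚ K] [NumberField.IsCMField K] (C : CornerProduct K), (M Bd hB K C).d3.A.CopiesEquivariant)
    (hOA : ∀ (Bd : BettiHodgeData ℂ) (hB : BettiClauses coeffC₀ Bd) (K : Type) [Field K] [NumberField K]
      [IsGalois ℚ K] [NumberField.IsCMField K] (C : CornerProduct K), (M Bd hB K C).d3.A.CopiesOrthogonal)
    (hInclA : ∀ (Bd : BettiHodgeData ℂ) (hB : BettiClauses coeffC₀ Bd) (K : Type) [Field K] [NumberField K]
      [IsGalois ℚ K] [NumberField.IsCMField K] (C : CornerProduct K), (M Bd hB K C).d3.A.CopiesIncl)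
    (hTauA : ∀ (Bd : BettiHodgeData ℂ) (hB : BettiClauses coeffC₀ Bd) (K : Type) [Field K] [NumberField K]
      [IsGalois ℚ K] [NumberField.IsCMField K] (C : CornerProduct K), (M Bd hB K C).d3.A.CopiesTauType)
    (hDecA : ∀ (Bd : BettiHodgeData ℂ) (hB : BettiClauses coeffC₀ Bd) (K : Type) [Field K] [NumberField K]
      [IsGalois ℚ K] [NumberField.IsCMField K] (C : CornerProduct K), (M Bd hB K C).d3.A.TauTypeDecomposes)
    (hFA : ∀ (Bd : BettiHodgeData ℂ) (hB : BettiClauses coeffC₀ Bd) (K : Type) [Field K] [NumberField K]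
      [IsGalois ℚ K] [NumberField.IsCMField K] (C : CornerProduct K), (M Bd hB K C).d3.A.LevelPartFinite)
    (hCA : ∀ (Bd : BettiHodgeData ℂ) (hB : BettiClauses coeffC₀ Bd) (K : Type) [Field K] [NumberField K]
      [IsGalois ℚ K] [NumberField.IsCMField K] (C : CornerProduct K), (M Bd hB K C).d3.A.LevelPartCont)
    (hAvgA : ∀ (Bd : BettiHodgeData ℂ) (hB : BettiClauses coeffC₀ Bd) (K : Type) [Field K] [NumberField K]
      [IsGalois ℚ K] [NumberField.IsCMField K] (C : CornerProduct K), (M Bd hB K C).d3.A.KAverage)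
    (hEqA : ∀ (Bd : BettiHodgeData ℂ) (hB : BettiClauses coeffC₀ Bd) (K : Type) [Field K] [NumberField K]
      [IsGalois ℚ K] [NumberField.IsCMField K] (C : CornerProduct K), (M Bd hB K C).d3.A.ThetaEquivariant)
    (hSpanA : ∀ (Bd : BettiHodgeData ℂ) (hB : BettiClauses coeffC₀ Bd) (K : Type) [Field K] [NumberField K]
      [IsGalois ℚ K] [NumberField.IsCMField K] (C : CornerProduct K), (M Bd hB K C).d3.A.SpanOfFixedVector)
    (hCOA : ∀ (Bd : BettiHodgeData ℂ) (hB : BettiClauses coeffC₀ Bd) (K : Type) [Field K] [NumberField K]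
      [IsGalois ℚ K] [NumberField.IsCMField K] (C : CornerProduct K), (M Bd hB K C).d3.A.CrossCopyOrthogonal)
    (hIndA : ∀ (Bd : BettiHodgeData ℂ) (hB : BettiClauses coeffC₀ Bd) (K : Type) [Field K] [NumberField K]
      [IsGalois ℚ K] [NumberField.IsCMField K] (C : CornerProduct K), (M Bd hB K C).d3.A.CopyIndependence)
    (hTSA : ∀ (Bd : BettiHodgeData ℂ) (hB : BettiClauses coeffC₀ Bd) (K : Type) [Field K] [NumberField K]
      [IsGalois ℚ K] [NumberField.IsCMField K] (C : CornerProduct K), (M Bd hB K C).d3.A.TensorsSpan)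
    -- N3B (t6-p3): the same on side B
    (ιB : ∀ (Bd : BettiHodgeData ℂ) (hB : BettiClauses coeffC₀ Bd) (K : Type) [Field K] [NumberField K]
      [IsGalois ℚ K] [NumberField.IsCMField K] (C : CornerProduct K), Type)
    (LB : ∀ (Bd : BettiHodgeData ℂ) (hB : BettiClauses coeffC₀ Bd) (K : Type) [Field K] [NumberField K]
      [IsGalois ℚ K] [NumberField.IsCMField K] (C : CornerProduct K), (ιB Bd hB K C) → HoweDualityShape)
    (hHDB : ∀ (Bd : BettiHodgeData ℂ) (hB : BettiClauses coeffC₀ Bd) (K : Type) [Field K] [NumberField K]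
      [IsGalois ℚ K] [NumberField.IsCMField K] (C : CornerProduct K), ∀ v, Hyp.GanTakeda2016_Thm1_2 ((LB Bd hB
      K C) v))
    (hHDbrB : ∀ (Bd : BettiHodgeData ℂ) (hB : BettiClauses coeffC₀ Bd) (K : Type) [Field K] [NumberField K]
      [IsGalois ℚ K] [NumberField.IsCMField K] (C : CornerProduct K), (M Bd hB K C).d3.HoweDualityBridge (LB
      Bd hB K C) (M Bd hB K C).d3.B)
    (hKCB : ∀ (Bd : BettiHodgeData ℂ) (hB : BettiClauses coeffC₀ Bd) (K : Type) [Field K] [NumberField K]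
      [IsGalois ℚ K] [NumberField.IsCMField K] (C : CornerProduct K), (M Bd hB K C).d3.B.KliftCont)
    (hSeamB : ∀ (Bd : BettiHodgeData ℂ) (hB : BettiClauses coeffC₀ Bd) (K : Type) [Field K] [NumberField K]
      [IsGalois ℚ K] [NumberField.IsCMField K] (C : CornerProduct K), (M Bd hB K C).d3.B.Seam (hKCB Bd hB K
      C))
    (hAdjB : ∀ (Bd : BettiHodgeData ℂ) (hB : BettiClauses coeffC₀ Bd) (K : Type) [Field K] [NumberField K]
      [IsGalois ℚ K] [NumberField.IsCMField K] (C : CornerProduct K), (M Bd hB K C).d3.B.Adjoint)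
    (hKLB : ∀ (Bd : BettiHodgeData ℂ) (hB : BettiClauses coeffC₀ Bd) (K : Type) [Field K] [NumberField K]
      [IsGalois ℚ K] [NumberField.IsCMField K] (C : CornerProduct K), (M Bd hB K C).d3.B.KliftLevel)
    (hΘτB : ∀ (Bd : BettiHodgeData ℂ) (hB : BettiClauses coeffC₀ Bd) (K : Type) [Field K] [NumberField K]
      [IsGalois ℚ K] [NumberField.IsCMField K] (C : CornerProduct K), (M Bd hB K C).d3.B.ThetaTauType (M Bd hB
      K C).d3.τiso)
    (hEB : ∀ (Bd : BettiHodgeData ℂ) (hB : BettiClauses coeffC₀ Bd) (K : Type) [Field K] [NumberField K]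
      [IsGalois ℚ K] [NumberField.IsCMField K] (C : CornerProduct K), (M Bd hB K C).d3.B.CopiesEquivariant)
    (hOB : ∀ (Bd : BettiHodgeData ℂ) (hB : BettiClauses coeffC₀ Bd) (K : Type) [Field K] [NumberField K]
      [IsGalois ℚ K] [NumberField.IsCMField K] (C : CornerProduct K), (M Bd hB K C).d3.B.CopiesOrthogonal)
    (hInclB : ∀ (Bd : BettiHodgeData ℂ) (hB : BettiClauses coeffC₀ Bd) (K : Type) [Field K] [NumberField K]
      [IsGalois ℚ K] [NumberField.IsCMField K] (C : CornerProduct K), (M Bd hB K C).d3.B.CopiesIncl)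
    (hTauB : ∀ (Bd : BettiHodgeData ℂ) (hB : BettiClauses coeffC₀ Bd) (K : Type) [Field K] [NumberField K]
      [IsGalois ℚ K] [NumberField.IsCMField K] (C : CornerProduct K), (M Bd hB K C).d3.B.CopiesTauType)
    (hDecB : ∀ (Bd : BettiHodgeData ℂ) (hB : BettiClauses coeffC₀ Bd) (K : Type) [Field K] [NumberField K]
      [IsGalois ℚ K] [NumberField.IsCMField K] (C : CornerProduct K), (M Bd hB K C).d3.B.TauTypeDecomposes)
    (hFB : ∀ (Bd : BettiHodgeData ℂ) (hB : BettiClauses coeffC₀ Bd) (K : Type) [Field K] [NumberField K]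
      [IsGalois ℚ K] [NumberField.IsCMField K] (C : CornerProduct K), (M Bd hB K C).d3.B.LevelPartFinite)
    (hCB : ∀ (Bd : BettiHodgeData ℂ) (hB : BettiClauses coeffC₀ Bd) (K : Type) [Field K] [NumberField K]
      [IsGalois ℚ K] [NumberField.IsCMField K] (C : CornerProduct K), (M Bd hB K C).d3.B.LevelPartCont)
    (hAvgB : ∀ (Bd : BettiHodgeData ℂ) (hB : BettiClauses coeffC₀ Bd) (K : Type) [Field K] [NumberField K]
      [IsGalois ℚ K] [NumberField.IsCMField K] (C : CornerProduct K), (M Bd hB K C).d3.B.KAverage)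
    (hEqB : ∀ (Bd : BettiHodgeData ℂ) (hB : BettiClauses coeffC₀ Bd) (K : Type) [Field K] [NumberField K]
      [IsGalois ℚ K] [NumberField.IsCMField K] (C : CornerProduct K), (M Bd hB K C).d3.B.ThetaEquivariant)
    (hSpanB : ∀ (Bd : BettiHodgeData ℂ) (hB : BettiClauses coeffC₀ Bd) (K : Type) [Field K] [NumberField K]
      [IsGalois ℚ K] [NumberField.IsCMField K] (C : CornerProduct K), (M Bd hB K C).d3.B.SpanOfFixedVector)
    (hCOB : ∀ (Bd : BettiHodgeData ℂ) (hB : BettiClauses coeffC₀ Bd) (K : Type) [Field K] [NumberField K]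
      [IsGalois ℚ K] [NumberField.IsCMField K] (C : CornerProduct K), (M Bd hB K C).d3.B.CrossCopyOrthogonal)
    (hIndB : ∀ (Bd : BettiHodgeData ℂ) (hB : BettiClauses coeffC₀ Bd) (K : Type) [Field K] [NumberField K]
      [IsGalois ℚ K] [NumberField.IsCMField K] (C : CornerProduct K), (M Bd hB K C).d3.B.CopyIndependence)
    (hTSB : ∀ (Bd : BettiHodgeData ℂ) (hB : BettiClauses coeffC₀ Bd) (K : Type) [Field K] [NumberField K]
      [IsGalois ℚ K] [NumberField.IsCMField K] (C : CornerProduct K), (M Bd hB K C).d3.B.TensorsSpan)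
    -- N4 (t6-p4): the binders of `N4_main`, verbatim, except the six (I-P2) binders, which come from
    -- the Bergman-explicit bundles `XA` / `XB` (t6-p6, T6N43BergmanPlaces) through `hxA` / `hxB` [EX]
    -- — at v5 the four (I-P2′) binders `hP2'₂ hP2'₃` per side are discharged the same way
    (XA XB : ∀ (Bd : BettiHodgeData ℂ) (hB : BettiClauses coeffC₀ Bd) (K : Type) [Field K] [NumberField K]
      [IsGalois ℚ K] [NumberField.IsCMField K] (C : CornerProduct K), N43Places.BergmanPlaces)
    (hxA : ∀ (Bd : BettiHodgeData ℂ) (hB : BettiClauses coeffC₀ Bd) (K : Type) [Field K] [NumberField K]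
      [IsGalois ℚ K] [NumberField.IsCMField K] (C : CornerProduct K), (M Bd hB K C).sA.d43 = (XA Bd hB K
      C).toPlaces)
    (hxB : ∀ (Bd : BettiHodgeData ℂ) (hB : BettiClauses coeffC₀ Bd) (K : Type) [Field K] [NumberField K]
      [IsGalois ℚ K] [NumberField.IsCMField K] (C : CornerProduct K), (M Bd hB K C).sB.d43 = (XB Bd hB K
      C).toPlaces)
    (hISA : ∀ (Bd : BettiHodgeData ℂ) (hB : BettiClauses coeffC₀ Bd) (K : Type) [Field K] [NumberField K]
      [IsGalois ℚ K] [NumberField.IsCMField K] (C : CornerProduct K), (M Bd hB K C).sA.d42.IrreducibleSmooth)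
    (hposA : ∀ (Bd : BettiHodgeData ℂ) (hB : BettiClauses coeffC₀ Bd) (K : Type) [Field K] [NumberField K]
      [IsGalois ℚ K] [NumberField.IsCMField K] (C : CornerProduct K), ∀ v, 0 < ((M Bd hB K
      C).sA.d42.splitDatum v).n)
    (hnmA : ∀ (Bd : BettiHodgeData ℂ) (hB : BettiClauses coeffC₀ Bd) (K : Type) [Field K] [NumberField K]
      [IsGalois ℚ K] [NumberField.IsCMField K] (C : CornerProduct K), (M Bd hB K C).sA.d42.TypeIISizes)
    (hFLA : ∀ (Bd : BettiHodgeData ℂ) (hB : BettiClauses coeffC₀ Bd) (K : Type) [Field K] [NumberField K]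
      [IsGalois ℚ K] [NumberField.IsCMField K] (C : CornerProduct K), (M Bd hB K C).sA.d42.FirstLift)
    (hMA : ∀ (Bd : BettiHodgeData ℂ) (hB : BettiClauses coeffC₀ Bd) (K : Type) [Field K] [NumberField K]
      [IsGalois ℚ K] [NumberField.IsCMField K] (C : CornerProduct K), ∀ v, Hyp.Minguez2008_Theoreme1_2 ((M Bd
      hB K C).sA.d42.splitDatum v))
    (hGIA : ∀ (Bd : BettiHodgeData ℂ) (hB : BettiClauses coeffC₀ Bd) (K : Type) [Field K] [NumberField K]
      [IsGalois ℚ K] [NumberField.IsCMField K] (C : CornerProduct K), ∀ v, Hyp.GanIchino2014_Prop5_3_i ((M Bd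
      hB K C).sA.d42.towerDatum v))
    (hEL₁A : ∀ (Bd : BettiHodgeData ℂ) (hB : BettiClauses coeffC₀ Bd) (K : Type) [Field K] [NumberField K]
      [IsGalois ℚ K] [NumberField.IsCMField K] (C : CornerProduct K), Hyp.EischenLiu2024_Sec2_2 2 0 (M Bd hB K
      C).sA.d43.τ₁ (M Bd hB K C).sA.d43.ν₁ (M Bd hB K C).sA.d43.r₁ ((M Bd hB K C).sA.d41.Lv (Sum.inr 0)))
    (hA2f₂A : ∀ (Bd : BettiHodgeData ℂ) (hB : BettiClauses coeffC₀ Bd) (K : Type) [Field K] [NumberField K]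
      [IsGalois ℚ K] [NumberField.IsCMField K] (C : CornerProduct K), Hyp.Ruhl1970_A2f (M Bd hB K
      C).sA.d43.d₂)
    (hEL₂A : ∀ (Bd : BettiHodgeData ℂ) (hB : BettiClauses coeffC₀ Bd) (K : Type) [Field K] [NumberField K]
      [IsGalois ℚ K] [NumberField.IsCMField K] (C : CornerProduct K), Hyp.EischenLiu2024_Sec2_2 1 1 (M Bd hB K
      C).sA.d43.τ₂ (M Bd hB K C).sA.d43.ν₂ (M Bd hB K C).sA.d43.r₂ ((M Bd hB K C).sA.d41.Lv (Sum.inr 1)))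
    (hA2f₃A : ∀ (Bd : BettiHodgeData ℂ) (hB : BettiClauses coeffC₀ Bd) (K : Type) [Field K] [NumberField K]
      [IsGalois ℚ K] [NumberField.IsCMField K] (C : CornerProduct K), Hyp.Ruhl1970_A2f (M Bd hB K
      C).sA.d43.d₃)
    (hEL₃A : ∀ (Bd : BettiHodgeData ℂ) (hB : BettiClauses coeffC₀ Bd) (K : Type) [Field K] [NumberField K]
      [IsGalois ℚ K] [NumberField.IsCMField K] (C : CornerProduct K), Hyp.EischenLiu2024_Sec2_2 1 1 (M Bd hB K
      C).sA.d43.τ₃ (M Bd hB K C).sA.d43.ν₃ (M Bd hB K C).sA.d43.r₃ ((M Bd hB K C).sA.d41.Lv (Sum.inr 2)))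
    (hB₁A : ∀ (Bd : BettiHodgeData ℂ) (hB : BettiClauses coeffC₀ Bd) (K : Type) [Field K] [NumberField K]
      [IsGalois ℚ K] [NumberField.IsCMField K] (C : CornerProduct K), Hyp.GQT2014_Conj11_5_obvious ((M Bd hB K
      C).sA.d43.withLfac fun j => (M Bd hB K C).sA.d41.Lv (Sum.inr j)).d₁ (M Bd hB K C).sA.d41 (Sum.inr 0))
    (hB₂A : ∀ (Bd : BettiHodgeData ℂ) (hB : BettiClauses coeffC₀ Bd) (K : Type) [Field K] [NumberField K]
      [IsGalois ℚ K] [NumberField.IsCMField K] (C : CornerProduct K), Hyp.GQT2014_Conj11_5_obvious ((M Bd hB K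
      C).sA.d43.withLfac fun j => (M Bd hB K C).sA.d41.Lv (Sum.inr j)).d₂ (M Bd hB K C).sA.d41 (Sum.inr 1))
    (hB₃A : ∀ (Bd : BettiHodgeData ℂ) (hB : BettiClauses coeffC₀ Bd) (K : Type) [Field K] [NumberField K]
      [IsGalois ℚ K] [NumberField.IsCMField K] (C : CornerProduct K), Hyp.GQT2014_Conj11_5_obvious ((M Bd hB K
      C).sA.d43.withLfac fun j => (M Bd hB K C).sA.d41.Lv (Sum.inr j)).d₃ (M Bd hB K C).sA.d41 (Sum.inr 2))
    (hGQTA : ∀ (Bd : BettiHodgeData ℂ) (hB : BettiClauses coeffC₀ Bd) (K : Type) [Field K] [NumberField K]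
      [IsGalois ℚ K] [NumberField.IsCMField K] (C : CornerProduct K), Hyp.GQT2014_Thm11_4_ii (M Bd hB K
      C).sA.d41)
    (hLRA : ∀ (Bd : BettiHodgeData ℂ) (hB : BettiClauses coeffC₀ Bd) (K : Type) [Field K] [NumberField K]
      [IsGalois ℚ K] [NumberField.IsCMField K] (C : CornerProduct K), Hyp.LapidRallis2005_Sec10_GlobalL (M Bd
      hB K C).sA.d41)
    (hpadicA : ∀ (Bd : BettiHodgeData ℂ) (hB : BettiClauses coeffC₀ Bd) (K : Type) [Field K] [NumberField K]
      [IsGalois ℚ K] [NumberField.IsCMField K] (C : CornerProduct K), Hyp.LapidRallis2005_Sec10_padic (M Bd hB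
      K C).sA.d41 (M Bd hB K C).sA.archSet)
    (hI₁eA : ∀ (Bd : BettiHodgeData ℂ) (hB : BettiClauses coeffC₀ Bd) (K : Type) [Field K] [NumberField K]
      [IsGalois ℚ K] [NumberField.IsCMField K] (C : CornerProduct K), Hyp.Iwasawa2019_Sec3_1_EulerProductE (M
      Bd hB K C).sA.d41.L₁ (M Bd hB K C).sA.d41.g₁)
    (hI₂eA : ∀ (Bd : BettiHodgeData ℂ) (hB : BettiClauses coeffC₀ Bd) (K : Type) [Field K] [NumberField K]
      [IsGalois ℚ K] [NumberField.IsCMField K] (C : CornerProduct K), Hyp.Iwasawa2019_Sec3_1_EulerProductE (M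
      Bd hB K C).sA.d41.L₂ (M Bd hB K C).sA.d41.g₂)
    (hI₁A : ∀ (Bd : BettiHodgeData ℂ) (hB : BettiClauses coeffC₀ Bd) (K : Type) [Field K] [NumberField K]
      [IsGalois ℚ K] [NumberField.IsCMField K] (C : CornerProduct K), Hyp.Iwasawa2019_Thm3_1 (M Bd hB K
      C).sA.d41.L₁ (M Bd hB K C).sA.d41.triv₁)
    (hI₂A : ∀ (Bd : BettiHodgeData ℂ) (hB : BettiClauses coeffC₀ Bd) (K : Type) [Field K] [NumberField K]
      [IsGalois ℚ K] [NumberField.IsCMField K] (C : CornerProduct K), Hyp.Iwasawa2019_Thm3_1 (M Bd hB K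
      C).sA.d41.L₂ (M Bd hB K C).sA.d41.triv₂)
    (hP₁A : ∀ (Bd : BettiHodgeData ℂ) (hB : BettiClauses coeffC₀ Bd) (K : Type) [Field K] [NumberField K]
      [IsGalois ℚ K] [NumberField.IsCMField K] (C : CornerProduct K), Hyp.Iwasawa2019_Prop4_4 (M Bd hB K
      C).sA.d41.L₁ (M Bd hB K C).sA.d41.triv₁)
    (hP₂A : ∀ (Bd : BettiHodgeData ℂ) (hB : BettiClauses coeffC₀ Bd) (K : Type) [Field K] [NumberField K]
      [IsGalois ℚ K] [NumberField.IsCMField K] (C : CornerProduct K), Hyp.Iwasawa2019_Prop4_4 (M Bd hB K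
      C).sA.d41.L₂ (M Bd hB K C).sA.d41.triv₂)
    -- the placement (P7) on side A (t6-p4, T6N41Place* + the (A″κ) layer T6N41PlaceKappa*): the data, SEVEN displays,
    -- the dichotomy [elementary], and the ONE residual `hκ'` [AD: TIER5 §N4.1.10 Lemma A′-4 (b4)–(b6), the local
    -- convention identity `κ_v(ϖ_v) = κ′(ϖ_v)⁻¹`] — in place of v6's `hunrA` (N4-PLACED-DROPIN.md option 1)
    (PlA : ∀ (Bd : BettiHodgeData ℂ) (hB : BettiClauses coeffC₀ Bd) (K : Type) [Field K] [NumberField K]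
      [IsGalois ℚ K] [NumberField.IsCMField K] (C : CornerProduct K), PlacementDatum (M Bd hB K C).sA.d41)
    (InA : ∀ (Bd : BettiHodgeData ℂ) (hB : BettiClauses coeffC₀ Bd) (K : Type) [Field K] [NumberField K]
      [IsGalois ℚ K] [NumberField.IsCMField K] (C : CornerProduct K), InertDatum (PlA Bd hB K C))
    (SpA : ∀ (Bd : BettiHodgeData ℂ) (hB : BettiClauses coeffC₀ Bd) (K : Type) [Field K] [NumberField K]
      [IsGalois ℚ K] [NumberField.IsCMField K] (C : CornerProduct K), SplitDatum (InA Bd hB K C))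
    (LQA : ∀ (Bd : BettiHodgeData ℂ) (hB : BettiClauses coeffC₀ Bd) (K : Type) [Field K] [NumberField K]
      [IsGalois ℚ K] [NumberField.IsCMField K] (C : CornerProduct K), SplitLQ (SpA Bd hB K C))
    (KdA : ∀ (Bd : BettiHodgeData ℂ) (hB : BettiClauses coeffC₀ Bd) (K : Type) [Field K] [NumberField K]
      [IsGalois ℚ K] [NumberField.IsCMField K] (C : CornerProduct K), KappaDatum (SpA Bd hB K C))
    (hLR7A : ∀ (Bd : BettiHodgeData ℂ) (hB : BettiClauses coeffC₀ Bd) (K : Type) [Field K] [NumberField K]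
      [IsGalois ℚ K] [NumberField.IsCMField K] (C : CornerProduct K), Hyp.LapidRallis2005_Sec7_Unramified (M
      Bd hB K C).sA.d41 (PlA Bd hB K C))
    (hBumpA : ∀ (Bd : BettiHodgeData ℂ) (hB : BettiClauses coeffC₀ Bd) (K : Type) [Field K] [NumberField K]
      [IsGalois ℚ K] [NumberField.IsCMField K] (C : CornerProduct K), Hyp.Bump1997_5_22 (PlA Bd hB K C))
    (hHaA : ∀ (Bd : BettiHodgeData ℂ) (hB : BettiClauses coeffC₀ Bd) (K : Type) [Field K] [NumberField K]
      [IsGalois ℚ K] [NumberField.IsCMField K] (C : CornerProduct K), Hyp.HarrisII2007_Prop2_2_5_b (InA Bd hB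
      K C))
    (hRoA : ∀ (Bd : BettiHodgeData ℂ) (hB : BettiClauses coeffC₀ Bd) (K : Type) [Field K] [NumberField K]
      [IsGalois ℚ K] [NumberField.IsCMField K] (C : CornerProduct K), Hyp.Rogawski1990_Sec11_4_BC (InA Bd hB K
      C))
    (hMinA : ∀ (Bd : BettiHodgeData ℂ) (hB : BettiClauses coeffC₀ Bd) (K : Type) [Field K] [NumberField K]
      [IsGalois ℚ K] [NumberField.IsCMField K] (C : CornerProduct K), Hyp.Minguez2008_Thm1_2_LQ (LQA Bd hB K
      C))
    (hB451A : ∀ (Bd : BettiHodgeData ℂ) (hB : BettiClauses coeffC₀ Bd) (K : Type) [Field K] [NumberField K]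
      [IsGalois ℚ K] [NumberField.IsCMField K] (C : CornerProduct K), Hyp.Bump1997_Thm4_5_1 (LQA Bd hB K C))
    (hRaoA : ∀ (Bd : BettiHodgeData ℂ) (hB : BettiClauses coeffC₀ Bd) (K : Type) [Field K] [NumberField K]
      [IsGalois ℚ K] [NumberField.IsCMField K] (C : CornerProduct K), Hyp.Rao1993_CorA5_1 (KdA Bd hB K C))
    (hdichA : ∀ (Bd : BettiHodgeData ℂ) (hB : BettiClauses coeffC₀ Bd) (K : Type) [Field K] [NumberField K]
      [IsGalois ℚ K] [NumberField.IsCMField K] (C : CornerProduct K), ∀ 𝔓, (PlA Bd hB K C).b 𝔓 ∉ (M Bd hB K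
      C).sA.d41.S → (InA Bd hB K C).inert 𝔓 ∨ (SpA Bd hB K C).splitPlace ((PlA Bd hB K C).b 𝔓))
    (hκ'A : ∀ (Bd : BettiHodgeData ℂ) (hB : BettiClauses coeffC₀ Bd) (K : Type) [Field K] [NumberField K]
      [IsGalois ℚ K] [NumberField.IsCMField K] (C : CornerProduct K), ∀ v, (SpA Bd hB K C).splitPlace v → v ∉
      (M Bd hB K C).sA.d41.S → (KdA Bd hB K C).κv v = ((KdA Bd hB K C).κ' v)⁻¹)
    (hRA : ∀ (Bd : BettiHodgeData ℂ) (hB : BettiClauses coeffC₀ Bd) (K : Type) [Field K] [NumberField K]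
      [IsGalois ℚ K] [NumberField.IsCMField K] (C : CornerProduct K), Hyp.GQT2014_Thm11_7_ii (M Bd hB K
      C).d3.A (M Bd hB K C).sA.d41)
    -- the τ′ layer on side A (t6-p4, T6N41Tau*): the pure-tensor test datum, the two GQT displays and t6-p5's
    -- `GQT2014_Prop35_i` at the split / non-split places — in place of v6's `hτ'A` [IR], now DISCHARGED
    (TdA : ∀ (Bd : BettiHodgeData ℂ) (hB : BettiClauses coeffC₀ Bd) (K : Type) [Field K] [NumberField K]
      [IsGalois ℚ K] [NumberField.IsCMField K] (C : CornerProduct K), TauDatum (M Bd hB K C).d3.A (M Bd hB K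
      C).sA)
    (hRIPA : ∀ (Bd : BettiHodgeData ℂ) (hB : BettiClauses coeffC₀ Bd) (K : Type) [Field K] [NumberField K]
      [IsGalois ℚ K] [NumberField.IsCMField K] (C : CornerProduct K), Hyp.GQT2014_Thm11_4_ii_Rallis (TdA Bd hB
      K C))
    (hU116A : ∀ (Bd : BettiHodgeData ℂ) (hB : BettiClauses coeffC₀ Bd) (K : Type) [Field K] [NumberField K]
      [IsGalois ℚ K] [NumberField.IsCMField K] (C : CornerProduct K), Hyp.GQT2014_Sec11_6_Unramified (TdA Bd
      hB K C))
    (hZsA : ∀ (Bd : BettiHodgeData ℂ) (hB : BettiClauses coeffC₀ Bd) (K : Type) [Field K] [NumberField K]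
      [IsGalois ℚ K] [NumberField.IsCMField K] (C : CornerProduct K), ∀ v, Hyp.GQT2014_Prop35_i ((M Bd hB K
      C).sA.d42.splitDatum v).pair ((M Bd hB K C).sA.d42.zetaSplit v))
    (hZnA : ∀ (Bd : BettiHodgeData ℂ) (hB : BettiClauses coeffC₀ Bd) (K : Type) [Field K] [NumberField K]
      [IsGalois ℚ K] [NumberField.IsCMField K] (C : CornerProduct K), ∀ v, Hyp.GQT2014_Prop35_i (((M Bd hB K
      C).sA.d42.towerDatum v).pair 1) ((M Bd hB K C).sA.d42.zetaNonsplit v))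
    (hISB : ∀ (Bd : BettiHodgeData ℂ) (hB : BettiClauses coeffC₀ Bd) (K : Type) [Field K] [NumberField K]
      [IsGalois ℚ K] [NumberField.IsCMField K] (C : CornerProduct K), (M Bd hB K C).sB.d42.IrreducibleSmooth)
    (hposB : ∀ (Bd : BettiHodgeData ℂ) (hB : BettiClauses coeffC₀ Bd) (K : Type) [Field K] [NumberField K]
      [IsGalois ℚ K] [NumberField.IsCMField K] (C : CornerProduct K), ∀ v, 0 < ((M Bd hB K
      C).sB.d42.splitDatum v).n)
    (hnmB : ∀ (Bd : BettiHodgeData ℂ) (hB : BettiClauses coeffC₀ Bd) (K : Type) [Field K] [NumberField K]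
      [IsGalois ℚ K] [NumberField.IsCMField K] (C : CornerProduct K), (M Bd hB K C).sB.d42.TypeIISizes)
    (hFLB : ∀ (Bd : BettiHodgeData ℂ) (hB : BettiClauses coeffC₀ Bd) (K : Type) [Field K] [NumberField K]
      [IsGalois ℚ K] [NumberField.IsCMField K] (C : CornerProduct K), (M Bd hB K C).sB.d42.FirstLift)
    (hMB : ∀ (Bd : BettiHodgeData ℂ) (hB : BettiClauses coeffC₀ Bd) (K : Type) [Field K] [NumberField K]
      [IsGalois ℚ K] [NumberField.IsCMField K] (C : CornerProduct K), ∀ v, Hyp.Minguez2008_Theoreme1_2 ((M Bd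
      hB K C).sB.d42.splitDatum v))
    (hGIB : ∀ (Bd : BettiHodgeData ℂ) (hB : BettiClauses coeffC₀ Bd) (K : Type) [Field K] [NumberField K]
      [IsGalois ℚ K] [NumberField.IsCMField K] (C : CornerProduct K), ∀ v, Hyp.GanIchino2014_Prop5_3_i ((M Bd
      hB K C).sB.d42.towerDatum v))
    (hEL₁B : ∀ (Bd : BettiHodgeData ℂ) (hB : BettiClauses coeffC₀ Bd) (K : Type) [Field K] [NumberField K]
      [IsGalois ℚ K] [NumberField.IsCMField K] (C : CornerProduct K), Hyp.EischenLiu2024_Sec2_2 2 0 (M Bd hB K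
      C).sB.d43.τ₁ (M Bd hB K C).sB.d43.ν₁ (M Bd hB K C).sB.d43.r₁ ((M Bd hB K C).sB.d41.Lv (Sum.inr 0)))
    (hA2f₂B : ∀ (Bd : BettiHodgeData ℂ) (hB : BettiClauses coeffC₀ Bd) (K : Type) [Field K] [NumberField K]
      [IsGalois ℚ K] [NumberField.IsCMField K] (C : CornerProduct K), Hyp.Ruhl1970_A2f (M Bd hB K
      C).sB.d43.d₂)
    (hEL₂B : ∀ (Bd : BettiHodgeData ℂ) (hB : BettiClauses coeffC₀ Bd) (K : Type) [Field K] [NumberField K]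
      [IsGalois ℚ K] [NumberField.IsCMField K] (C : CornerProduct K), Hyp.EischenLiu2024_Sec2_2 1 1 (M Bd hB K
      C).sB.d43.τ₂ (M Bd hB K C).sB.d43.ν₂ (M Bd hB K C).sB.d43.r₂ ((M Bd hB K C).sB.d41.Lv (Sum.inr 1)))
    (hA2f₃B : ∀ (Bd : BettiHodgeData ℂ) (hB : BettiClauses coeffC₀ Bd) (K : Type) [Field K] [NumberField K]
      [IsGalois ℚ K] [NumberField.IsCMField K] (C : CornerProduct K), Hyp.Ruhl1970_A2f (M Bd hB K
      C).sB.d43.d₃)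
    (hEL₃B : ∀ (Bd : BettiHodgeData ℂ) (hB : BettiClauses coeffC₀ Bd) (K : Type) [Field K] [NumberField K]
      [IsGalois ℚ K] [NumberField.IsCMField K] (C : CornerProduct K), Hyp.EischenLiu2024_Sec2_2 1 1 (M Bd hB K
      C).sB.d43.τ₃ (M Bd hB K C).sB.d43.ν₃ (M Bd hB K C).sB.d43.r₃ ((M Bd hB K C).sB.d41.Lv (Sum.inr 2)))
    (hB₁B : ∀ (Bd : BettiHodgeData ℂ) (hB : BettiClauses coeffC₀ Bd) (K : Type) [Field K] [NumberField K]
      [IsGalois ℚ K] [NumberField.IsCMField K] (C : CornerProduct K), Hyp.GQT2014_Conj11_5_obvious ((M Bd hB K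
      C).sB.d43.withLfac fun j => (M Bd hB K C).sB.d41.Lv (Sum.inr j)).d₁ (M Bd hB K C).sB.d41 (Sum.inr 0))
    (hB₂B : ∀ (Bd : BettiHodgeData ℂ) (hB : BettiClauses coeffC₀ Bd) (K : Type) [Field K] [NumberField K]
      [IsGalois ℚ K] [NumberField.IsCMField K] (C : CornerProduct K), Hyp.GQT2014_Conj11_5_obvious ((M Bd hB K
      C).sB.d43.withLfac fun j => (M Bd hB K C).sB.d41.Lv (Sum.inr j)).d₂ (M Bd hB K C).sB.d41 (Sum.inr 1))
    (hB₃B : ∀ (Bd : BettiHodgeData ℂ) (hB : BettiClauses coeffC₀ Bd) (K : Type) [Field K] [NumberField K]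
      [IsGalois ℚ K] [NumberField.IsCMField K] (C : CornerProduct K), Hyp.GQT2014_Conj11_5_obvious ((M Bd hB K
      C).sB.d43.withLfac fun j => (M Bd hB K C).sB.d41.Lv (Sum.inr j)).d₃ (M Bd hB K C).sB.d41 (Sum.inr 2))
    (hGQTB : ∀ (Bd : BettiHodgeData ℂ) (hB : BettiClauses coeffC₀ Bd) (K : Type) [Field K] [NumberField K]
      [IsGalois ℚ K] [NumberField.IsCMField K] (C : CornerProduct K), Hyp.GQT2014_Thm11_4_ii (M Bd hB K
      C).sB.d41)
    (hLRB : ∀ (Bd : BettiHodgeData ℂ) (hB : BettiClauses coeffC₀ Bd) (K : Type) [Field K] [NumberField K]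
      [IsGalois ℚ K] [NumberField.IsCMField K] (C : CornerProduct K), Hyp.LapidRallis2005_Sec10_GlobalL (M Bd
      hB K C).sB.d41)
    (hpadicB : ∀ (Bd : BettiHodgeData ℂ) (hB : BettiClauses coeffC₀ Bd) (K : Type) [Field K] [NumberField K]
      [IsGalois ℚ K] [NumberField.IsCMField K] (C : CornerProduct K), Hyp.LapidRallis2005_Sec10_padic (M Bd hB
      K C).sB.d41 (M Bd hB K C).sB.archSet)
    (hI₁eB : ∀ (Bd : BettiHodgeData ℂ) (hB : BettiClauses coeffC₀ Bd) (K : Type) [Field K] [NumberField K]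
      [IsGalois ℚ K] [NumberField.IsCMField K] (C : CornerProduct K), Hyp.Iwasawa2019_Sec3_1_EulerProductE (M
      Bd hB K C).sB.d41.L₁ (M Bd hB K C).sB.d41.g₁)
    (hI₂eB : ∀ (Bd : BettiHodgeData ℂ) (hB : BettiClauses coeffC₀ Bd) (K : Type) [Field K] [NumberField K]
      [IsGalois ℚ K] [NumberField.IsCMField K] (C : CornerProduct K), Hyp.Iwasawa2019_Sec3_1_EulerProductE (M
      Bd hB K C).sB.d41.L₂ (M Bd hB K C).sB.d41.g₂)
    (hI₁B : ∀ (Bd : BettiHodgeData ℂ) (hB : BettiClauses coeffC₀ Bd) (K : Type) [Field K] [NumberField K]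
      [IsGalois ℚ K] [NumberField.IsCMField K] (C : CornerProduct K), Hyp.Iwasawa2019_Thm3_1 (M Bd hB K
      C).sB.d41.L₁ (M Bd hB K C).sB.d41.triv₁)
    (hI₂B : ∀ (Bd : BettiHodgeData ℂ) (hB : BettiClauses coeffC₀ Bd) (K : Type) [Field K] [NumberField K]
      [IsGalois ℚ K] [NumberField.IsCMField K] (C : CornerProduct K), Hyp.Iwasawa2019_Thm3_1 (M Bd hB K
      C).sB.d41.L₂ (M Bd hB K C).sB.d41.triv₂)
    (hP₁B : ∀ (Bd : BettiHodgeData ℂ) (hB : BettiClauses coeffC₀ Bd) (K : Type) [Field K] [NumberField K]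
      [IsGalois ℚ K] [NumberField.IsCMField K] (C : CornerProduct K), Hyp.Iwasawa2019_Prop4_4 (M Bd hB K
      C).sB.d41.L₁ (M Bd hB K C).sB.d41.triv₁)
    (hP₂B : ∀ (Bd : BettiHodgeData ℂ) (hB : BettiClauses coeffC₀ Bd) (K : Type) [Field K] [NumberField K]
      [IsGalois ℚ K] [NumberField.IsCMField K] (C : CornerProduct K), Hyp.Iwasawa2019_Prop4_4 (M Bd hB K
      C).sB.d41.L₂ (M Bd hB K C).sB.d41.triv₂)
    -- the placement (P7) on side B (t6-p4, T6N41Place* + the (A″κ) layer T6N41PlaceKappa*): the data, SEVEN displays,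
    -- the dichotomy [elementary], and the ONE residual `hκ'` [AD: TIER5 §N4.1.10 Lemma A′-4 (b4)–(b6), the local
    -- convention identity `κ_v(ϖ_v) = κ′(ϖ_v)⁻¹`] — in place of v6's `hunrB` (N4-PLACED-DROPIN.md option 1)
    (PlB : ∀ (Bd : BettiHodgeData ℂ) (hB : BettiClauses coeffC₀ Bd) (K : Type) [Field K] [NumberField K]
      [IsGalois ℚ K] [NumberField.IsCMField K] (C : CornerProduct K), PlacementDatum (M Bd hB K C).sB.d41)
    (InB : ∀ (Bd : BettiHodgeData ℂ) (hB : BettiClauses coeffC₀ Bd) (K : Type) [Field K] [NumberField K]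
      [IsGalois ℚ K] [NumberField.IsCMField K] (C : CornerProduct K), InertDatum (PlB Bd hB K C))
    (SpB : ∀ (Bd : BettiHodgeData ℂ) (hB : BettiClauses coeffC₀ Bd) (K : Type) [Field K] [NumberField K]
      [IsGalois ℚ K] [NumberField.IsCMField K] (C : CornerProduct K), SplitDatum (InB Bd hB K C))
    (LQB : ∀ (Bd : BettiHodgeData ℂ) (hB : BettiClauses coeffC₀ Bd) (K : Type) [Field K] [NumberField K]
      [IsGalois ℚ K] [NumberField.IsCMField K] (C : CornerProduct K), SplitLQ (SpB Bd hB K C))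
    (KdB : ∀ (Bd : BettiHodgeData ℂ) (hB : BettiClauses coeffC₀ Bd) (K : Type) [Field K] [NumberField K]
      [IsGalois ℚ K] [NumberField.IsCMField K] (C : CornerProduct K), KappaDatum (SpB Bd hB K C))
    (hLR7B : ∀ (Bd : BettiHodgeData ℂ) (hB : BettiClauses coeffC₀ Bd) (K : Type) [Field K] [NumberField K]
      [IsGalois ℚ K] [NumberField.IsCMField K] (C : CornerProduct K), Hyp.LapidRallis2005_Sec7_Unramified (M
      Bd hB K C).sB.d41 (PlB Bd hB K C))
    (hBumpB : ∀ (Bd : BettiHodgeData ℂ) (hB : BettiClauses coeffC₀ Bd) (K : Type) [Field K] [NumberField K]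
      [IsGalois ℚ K] [NumberField.IsCMField K] (C : CornerProduct K), Hyp.Bump1997_5_22 (PlB Bd hB K C))
    (hHaB : ∀ (Bd : BettiHodgeData ℂ) (hB : BettiClauses coeffC₀ Bd) (K : Type) [Field K] [NumberField K]
      [IsGalois ℚ K] [NumberField.IsCMField K] (C : CornerProduct K), Hyp.HarrisII2007_Prop2_2_5_b (InB Bd hB
      K C))
    (hRoB : ∀ (Bd : BettiHodgeData ℂ) (hB : BettiClauses coeffC₀ Bd) (K : Type) [Field K] [NumberField K]
      [IsGalois ℚ K] [NumberField.IsCMField K] (C : CornerProduct K), Hyp.Rogawski1990_Sec11_4_BC (InB Bd hB K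
      C))
    (hMinB : ∀ (Bd : BettiHodgeData ℂ) (hB : BettiClauses coeffC₀ Bd) (K : Type) [Field K] [NumberField K]
      [IsGalois ℚ K] [NumberField.IsCMField K] (C : CornerProduct K), Hyp.Minguez2008_Thm1_2_LQ (LQB Bd hB K
      C))
    (hB451B : ∀ (Bd : BettiHodgeData ℂ) (hB : BettiClauses coeffC₀ Bd) (K : Type) [Field K] [NumberField K]
      [IsGalois ℚ K] [NumberField.IsCMField K] (C : CornerProduct K), Hyp.Bump1997_Thm4_5_1 (LQB Bd hB K C))
    (hRaoB : ∀ (Bd : BettiHodgeData ℂ) (hB : BettiClauses coeffC₀ Bd) (K : Type) [Field K] [NumberField K]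
      [IsGalois ℚ K] [NumberField.IsCMField K] (C : CornerProduct K), Hyp.Rao1993_CorA5_1 (KdB Bd hB K C))
    (hdichB : ∀ (Bd : BettiHodgeData ℂ) (hB : BettiClauses coeffC₀ Bd) (K : Type) [Field K] [NumberField K]
      [IsGalois ℚ K] [NumberField.IsCMField K] (C : CornerProduct K), ∀ 𝔓, (PlB Bd hB K C).b 𝔓 ∉ (M Bd hB K
      C).sB.d41.S → (InB Bd hB K C).inert 𝔓 ∨ (SpB Bd hB K C).splitPlace ((PlB Bd hB K C).b 𝔓))
    (hκ'B : ∀ (Bd : BettiHodgeData ℂ) (hB : BettiClauses coeffC₀ Bd) (K : Type) [Field K] [NumberField K]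
      [IsGalois ℚ K] [NumberField.IsCMField K] (C : CornerProduct K), ∀ v, (SpB Bd hB K C).splitPlace v → v ∉
      (M Bd hB K C).sB.d41.S → (KdB Bd hB K C).κv v = ((KdB Bd hB K C).κ' v)⁻¹)
    (hRB : ∀ (Bd : BettiHodgeData ℂ) (hB : BettiClauses coeffC₀ Bd) (K : Type) [Field K] [NumberField K]
      [IsGalois ℚ K] [NumberField.IsCMField K] (C : CornerProduct K), Hyp.GQT2014_Thm11_7_ii (M Bd hB K
      C).d3.B (M Bd hB K C).sB.d41)
    -- the τ′ layer on side B (t6-p4, T6N41Tau*): the pure-tensor test datum, the two GQT displays and t6-p5's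
    -- `GQT2014_Prop35_i` at the split / non-split places — in place of v6's `hτ'B` [IR], now DISCHARGED
    (TdB : ∀ (Bd : BettiHodgeData ℂ) (hB : BettiClauses coeffC₀ Bd) (K : Type) [Field K] [NumberField K]
      [IsGalois ℚ K] [NumberField.IsCMField K] (C : CornerProduct K), TauDatum (M Bd hB K C).d3.B (M Bd hB K
      C).sB)
    (hRIPB : ∀ (Bd : BettiHodgeData ℂ) (hB : BettiClauses coeffC₀ Bd) (K : Type) [Field K] [NumberField K]
      [IsGalois ℚ K] [NumberField.IsCMField K] (C : CornerProduct K), Hyp.GQT2014_Thm11_4_ii_Rallis (TdB Bd hB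
      K C))
    (hU116B : ∀ (Bd : BettiHodgeData ℂ) (hB : BettiClauses coeffC₀ Bd) (K : Type) [Field K] [NumberField K]
      [IsGalois ℚ K] [NumberField.IsCMField K] (C : CornerProduct K), Hyp.GQT2014_Sec11_6_Unramified (TdB Bd
      hB K C))
    (hZsB : ∀ (Bd : BettiHodgeData ℂ) (hB : BettiClauses coeffC₀ Bd) (K : Type) [Field K] [NumberField K]
      [IsGalois ℚ K] [NumberField.IsCMField K] (C : CornerProduct K), ∀ v, Hyp.GQT2014_Prop35_i ((M Bd hB K
      C).sB.d42.splitDatum v).pair ((M Bd hB K C).sB.d42.zetaSplit v))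
    (hZnB : ∀ (Bd : BettiHodgeData ℂ) (hB : BettiClauses coeffC₀ Bd) (K : Type) [Field K] [NumberField K]
      [IsGalois ℚ K] [NumberField.IsCMField K] (C : CornerProduct K), ∀ v, Hyp.GQT2014_Prop35_i (((M Bd hB K
      C).sB.d42.towerDatum v).pair 1) ((M Bd hB K C).sB.d42.zetaNonsplit v))
    -- N5 (t6-p7, RE-CUT ON THE RICH DATUM — T6N5Rich / T6N5RichMain / T6N5RichSH): Theorem 5.6 on the datum's two
    -- sides [PO]; the rich datum `R5` with `hR5` [EX, by construction]; the construction facts `hL` [EX — N5.L1 ×2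
    -- a theorem]; (S–H) through N2's `M.AdmDatum` via `dict` / `hA` / `hB` [EX — (a) ×2 a theorem]; the local
    -- solutions `hsol` [EX, witnessed per place by t6-p8 — (b) at the finite places a theorem]; (b) at the real
    -- places `hre` [IR here; display-level discharge in T6N5RealPlace + T6N5FockMain]; (c) `hc5` [EX]
    (hT : ∀ (Bd : BettiHodgeData ℂ) (hB : BettiClauses coeffC₀ Bd) (K : Type) [Field K] [NumberField K]
      [IsGalois ℚ K] [NumberField.IsCMField K] (C : CornerProduct K), Hyp.BFGYYZ2025_Thm5_6 ({(M Bd hB K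
      C).d5.A, (M Bd hB K C).d5.B} : Set (ToricSide (M Bd hB K C).ι5 (M Bd hB K C).G5)))
    (R5 : ∀ (Bd : BettiHodgeData ℂ) (hB : BettiClauses coeffC₀ Bd) (K : Type) [Field K] [NumberField K]
      [IsGalois ℚ K] [NumberField.IsCMField K] (C : CornerProduct K), N5Rich.RichData (M Bd hB K C).ι5 (M Bd
      hB K C).G5)
    (hR5 : ∀ (Bd : BettiHodgeData ℂ) (hB : BettiClauses coeffC₀ Bd) (K : Type) [Field K] [NumberField K]
      [IsGalois ℚ K] [NumberField.IsCMField K] (C : CornerProduct K), (M Bd hB K C).d5 = (R5 Bd hB K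
      C).toN5Data)
    (hL : ∀ (Bd : BettiHodgeData ℂ) (hB : BettiClauses coeffC₀ Bd) (K : Type) [Field K] [NumberField K]
      [IsGalois ℚ K] [NumberField.IsCMField K] (C : CornerProduct K), (R5 Bd hB K C).LevelHyps)
    (dict : ∀ (Bd : BettiHodgeData ℂ) (hB : BettiClauses coeffC₀ Bd) (K : Type) [Field K] [NumberField K]
      [IsGalois ℚ K] [NumberField.IsCMField K] (C : CornerProduct K), (M Bd hB K C).d2.Char →* (M Bd hB K
      C).G5)
    (hA : ∀ (Bd : BettiHodgeData ℂ) (hB : BettiClauses coeffC₀ Bd) (K : Type) [Field K] [NumberField K]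
      [IsGalois ℚ K] [NumberField.IsCMField K] (C : CornerProduct K), (R5 Bd hB K C).rA = (dict Bd hB K C) ((M
      Bd hB K C).d2.χ₁₁₁ * (M Bd hB K C).d2.χ₁₀₀))
    (hB : ∀ (Bd : BettiHodgeData ℂ) (hB : BettiClauses coeffC₀ Bd) (K : Type) [Field K] [NumberField K]
      [IsGalois ℚ K] [NumberField.IsCMField K] (C : CornerProduct K), (R5 Bd hB K C).rB = (dict Bd hB K C) ((M
      Bd hB K C).d2.χ₁₀₁ * (M Bd hB K C).d2.χ₁₁₀))
    (hsol : ∀ (Bd : BettiHodgeData ℂ) (hB : BettiClauses coeffC₀ Bd) (K : Type) [Field K] [NumberField K]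
      [IsGalois ℚ K] [NumberField.IsCMField K] (C : CornerProduct K), (R5 Bd hB K C).S.Solves)
    (hre : ∀ (Bd : BettiHodgeData ℂ) (hB : BettiClauses coeffC₀ Bd) (K : Type) [Field K] [NumberField K]
      [IsGalois ℚ K] [NumberField.IsCMField K] (C : CornerProduct K), (R5 Bd hB K C).S.RealCondB)
    (hc5 : ∀ (Bd : BettiHodgeData ℂ) (hB : BettiClauses coeffC₀ Bd) (K : Type) [Field K] [NumberField K]
      [IsGalois ℚ K] [NumberField.IsCMField K] (C : CornerProduct K), (M Bd hB K C).d5.condC),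
    HostAPI.HCCM.Statement

end Summit.Ventures.HodgeRepro2.T6

end
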